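import Mathlib
import Literature.Analysis.FluidPDE.CheskidovFriedlander2009.Existence
import Literature.Analysis.FluidPDE.CheskidovFriedlander2009.GlobalAttractor
import HarnessLib

/-!
# Global existence of (weak) solutions for every `ℓ²` datum: Cheskidov 2008 Thm. 4.1 (any
# dissipation degree, `ν ≥ 0`), Cheskidov–Friedlander 2009 Thm. 3.2 and
# Cheskidov–Friedlander–Pavlović 2010 Thm. 3.2 (the inviscid model) — PROVED

The tree proves existence for Cheskidov's dyadic model (3.1) only in the strong regime `α ≥ 1/2`,
`ν > 0` (`Cheskidov2008_thm44_holds`), whence for the Cheskidov–Friedlander model (1.2) only for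
`0 < c ≤ 2`, `ν > 0` and `H¹` data (`exists_isSolution`, `Existence.lean`).  This file proves the
WEAK existence theorem with the same Galerkin/compactness proof, which needs neither `α ≥ 1/2` nor
`ν > 0`:

* `exists_isCheskidovSolution_of_summable` — A. Cheskidov, Trans. AMS 360 (2008) 5101–5120,
  **Thm. 4.1** ("For every `u⁰ ∈ H`, there exists a weak solution of (3.1) on `[0,∞)` with
  `u(0) = u⁰`"), here for `λ > 1`, every `α`, every `ν ≥ 0` and every force with `Σgₙ² < ∞`:
  Galerkin truncations (`exists_galerkin_solution`), the level-uniform energy bound (`energy_le`,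
  valid for `ν ≥ 0`), modewise equi-Lipschitz bounds (`abs_cheskidovRHS_succ_le`), the diagonal
  extraction `exists_subseq_tendsto`, passage to the limit in the integral form by dominated
  convergence and the fundamental theorem of calculus — verbatim the steps of the tree's
  `exists_strong_solution_of_half_le` (`DyadicCascadeRegularityProofs.lean`) with the enstrophy
  estimate removed; the limit is in `ℓ²` by the energy bound on partial sums.
* `exists_isSolution_of_summable` — via the dictionary `IsSolution.of_isCheskidovSolution`
  (`λ = 2^c`, `α = 1/c`, `ν/4`, modes shifted by one): for every `c > 0`, `ν ≥ 0`, `f₀ ∈ ℝ` and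
  every `a⁰ ∈ ℓ²` the Cheskidov–Friedlander system (1.2) has a solution on `[0,∞)` (Def. 3.1) with
  `a(0) = a⁰` — **Cheskidov–Friedlander 2009, Thm. 3.2** (existence clause; printed for
  `c ∈ (3/2, 5/2]`, `ν > 0`, `a⁰ ∈ l²`, "a classical result from [2]") in full, and, at `ν = 0`,
  **Cheskidov–Friedlander–Pavlović 2010, Thm. 3.2** ("For every `a⁰ ∈ H`, there exists a solution
  of (1.2) on `[0,∞)` with `a(0) = a⁰`", proof p. 4–5: Galerkin, Ascoli–Arzelà in `C([0,T];H_w)`).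
  In particular the hypotheses of the proved Thms. 4.3, 4.4, 4.5 and Cor. 4.6
  (`InviscidAttractor.lean`, `InviscidEnergyEquality.lean`, `InviscidCriticalBlowup.lean`) are met by
  a solution from every non-negative `ℓ²` datum (`exists_isSolution_inviscid`).

No new definitions, no new facts.

## References
* [Cheskidov2008] A. Cheskidov, Blow-up in finite time for the dyadic model of the Navier–Stokes
  equations, Trans. AMS 360 (2008), §4 Thm. 4.1 and its proof.
* [CheskidovFriedlander2009] A. Cheskidov, S. Friedlander, Physica D 238 (2009), Thm. 3.2 p. 7.
* [CheskidovFriedlanderPavlovic2010] A. Cheskidov, S. Friedlander, N. Pavlović, DCDS 26 (2010),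
  Thm. 3.2 and its proof, pp. 4–5 (arXiv:math/0610815v1).
-/

noncomputable section

open Filter Set MeasureTheory Metric
open scoped Topology ENNReal BigOperators NNReal

namespace Literature.Analysis.FluidPDE.CheskidovFriedlander2009

open Literature.Barriers.NavierStokesRegularity.Dyadic

/-! ### Cheskidov 2008, Thm. 4.1: weak solutions for every `ℓ²` datum -/

/-- **Cheskidov 2008, Theorem 4.1 (global weak solutions), for every dissipation degree and
`ν ≥ 0`**: for `λ > 1`, `ν ≥ 0`, any `α`, every force with `Σ_{n≥1}gₙ² < ∞` and every datum with
`Σ_{n≥1}(u⁰ₙ)² < ∞` there is a solution of (3.1) on `[0,∞)` in the sense of Def. 3.1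
(`IsCheskidovSolution`) with `u(0) = u⁰`, obeying the energy bound
`Σ_{n≤M}uₙ(t)² ≤ (Σ_n(u⁰ₙ)² + Σ_ngₙ²)eᵀ` on `[0,T]`.  Printed for `ν > 0` (standing hypothesis of
§3); the proof (Galerkin approximations, uniform energy bound, equicontinuity, Ascoli–Arzelà and
diagonalization, passage to the limit in the integral form) uses only `ν ≥ 0` and is the one of
Cheskidov–Friedlander–Pavlović 2010 Thm. 3.2 at `ν = 0`.
[cite: Cheskidov2008, §4 Thm. 4.1 (statement and proof)] [cite: CheskidovFriedlanderPavlovic2010, Thm 3.2 p.4–5] -/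
theorem exists_isCheskidovSolution_of_summable {lam ν α : ℝ} (hlam : 1 < lam) (hν : 0 ≤ ν)
    (g : ℕ → ℝ) (hgs : Summable fun n => g (n + 1) ^ 2) (u0 : ℕ → ℝ)
    (hu0 : Summable fun n => u0 (n + 1) ^ 2) :
    ∃ u : ℕ → ℝ → ℝ, IsCheskidovSolution lam ν α g u0 u ∧
      ∀ T : ℝ, 0 ≤ T → ∀ t ∈ Icc 0 T, ∀ M : ℕ,
        ∑ m ∈ Finset.range M, u (m + 1) t ^ 2 ≤
          ((∑' m, u0 (m + 1) ^ 2) + ∑' m, g (m + 1) ^ 2) * Real.exp T := by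
  have hlam0 : (0 : ℝ) ≤ lam := by linarith
  -- the force
  set G : ℝ := ∑' m, g (m + 1) ^ 2 with hG
  have hGN : ∀ N, ∑ m ∈ Finset.range N, g (m + 1) ^ 2 ≤ G := fun N =>
    hgs.sum_le_tsum (Finset.range N) (fun m _ => sq_nonneg _)
  have hG0 : 0 ≤ G := tsum_nonneg fun m => sq_nonneg _
  -- the datum
  set S0 : ℝ := ∑' m, u0 (m + 1) ^ 2 with hS0
  have hS0E : ∀ M, ∑ m ∈ Finset.range M, u0 (m + 1) ^ 2 ≤ S0 := fun M =>
    hu0.sum_le_tsum (Finset.range M) (fun m _ => sq_nonneg _)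
  have hS0nn : 0 ≤ S0 := tsum_nonneg fun m => sq_nonneg _
  -- Step 1: the Galerkin approximations
  choose U hU0 hUgt hUinit hUd using fun N => exists_galerkin_solution (α := α) hlam hν g u0 N
  have hUN1 : ∀ N t, U N (N + 1) t = 0 := fun N t => hUgt N (N + 1) (Nat.lt_succ_self N) t
  -- Step 2a: the energy bound
  set R2 : ℝ → ℝ := fun T => (S0 + G) * Real.exp T with hR2
  have hR2nn : ∀ T, 0 ≤ R2 T := fun T => by simp only [hR2]; positivity
  have hEN : ∀ N T, ∀ t ∈ Icc 0 T, ∑ m ∈ Finset.range N, U N (m + 1) t ^ 2 ≤ R2 T := by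
    intro N T t ht
    have h := energy_le (hU0 N) (hUN1 N) (hUd N T) hν hlam (hGN N) t ht
    refine h.trans ?_
    have hinit : ∑ m ∈ Finset.range N, U N (m + 1) 0 ^ 2 ≤ S0 := by
      calc ∑ m ∈ Finset.range N, U N (m + 1) 0 ^ 2 = ∑ m ∈ Finset.range N, u0 (m + 1) ^ 2 :=
            Finset.sum_congr rfl fun m hm => by
              rw [hUinit N (m + 1) (by omega) (by have := Finset.mem_range.1 hm; omega)]
        _ ≤ S0 := hS0E N
    have := Real.exp_pos T
    simp only [hR2]
    nlinarith
  -- the energy bound for all partial sums (modes above the level vanish)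
  have hEN' : ∀ N T, ∀ t ∈ Icc 0 T, ∀ M, ∑ m ∈ Finset.range M, U N (m + 1) t ^ 2 ≤ R2 T := by
    intro N T t ht M
    have hsplit : ∑ m ∈ Finset.range M, U N (m + 1) t ^ 2 ≤ ∑ m ∈ Finset.range N, U N (m + 1) t ^ 2 := by
      have h1 : ∑ m ∈ Finset.range M, U N (m + 1) t ^ 2 =
          ∑ m ∈ Finset.range M ∩ Finset.range N, U N (m + 1) t ^ 2 := by
        refine (Finset.sum_subset Finset.inter_subset_left fun m hm hmn => ?_).symm
        have hmN : ¬ m < N := fun h => hmn (Finset.mem_inter.2 ⟨hm, Finset.mem_range.2 h⟩)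
        rw [hUgt N (m + 1) (by omega) t]
        ring
      rw [h1]
      exact Finset.sum_le_sum_of_subset_of_nonneg Finset.inter_subset_right fun m _ _ => sq_nonneg _
    exact hsplit.trans (hEN N T t ht)
  set R : ℝ → ℝ := fun T => Real.sqrt (R2 T) with hR
  have hR0 : ∀ T, 0 ≤ R T := fun T => Real.sqrt_nonneg _
  have hUabs : ∀ T, ∀ t ∈ Icc 0 T, ∀ N n, |U N n t| ≤ R T := by
    intro T t ht N n
    rcases Nat.eq_zero_or_pos n with rfl | hn
    · rw [hU0]; simpa using hR0 T
    obtain ⟨m, rfl⟩ : ∃ m, n = m + 1 := ⟨n - 1, by omega⟩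
    by_cases hm : m < N
    · refine Real.abs_le_sqrt ?_
      exact le_trans (Finset.single_le_sum (f := fun m => U N (m + 1) t ^ 2)
        (fun _ _ => sq_nonneg _) (Finset.mem_range.2 hm)) (hEN N T t ht)
    · rw [hUgt N (m + 1) (by omega)]; simpa using hR0 T
  -- Step 2c: bounds on the time derivatives, equi-Lipschitz estimates
  set L : ℕ → ℝ → ℝ := fun m T => ν * lam ^ (2 * α * (m + 1 : ℕ)) * R T + lam ^ (m + 1) * R T ^ 2 +
    lam ^ (m + 2) * R T ^ 2 + |g (m + 1)| with hL
  have hderiv_bd : ∀ N T, ∀ t ∈ Icc 0 T, ∀ m,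
      |cheskidovRHS lam ν α g (fun k => U N k t) (m + 1)| ≤ L m T := fun N T t ht m =>
    abs_cheskidovRHS_succ_le hν hlam0 g (hR0 T) (fun k => hUabs T t ht N k) m
  have hlipU : ∀ T, 0 ≤ T → ∀ n, ∃ L', ∀ N, ∀ s ∈ Icc 0 T, ∀ t ∈ Icc 0 T,
      |U N n t - U N n s| ≤ L' * |t - s| := by
    intro T hT n
    rcases Nat.eq_zero_or_pos n with rfl | hn
    · exact ⟨0, fun N s _ t _ => by simp [hU0]⟩
    obtain ⟨m, rfl⟩ : ∃ m, n = m + 1 := ⟨n - 1, by omega⟩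
    refine ⟨L m T, fun N s hs t ht => ?_⟩
    by_cases hm : m < N
    · have := Convex.norm_image_sub_le_of_norm_hasDerivWithin_le (C := L m T)
        (fun τ hτ => hUd N T m hm τ hτ)
        (fun τ hτ => by rw [Real.norm_eq_abs]; exact hderiv_bd N T τ hτ m) (convex_Icc 0 T) hs ht
      simpa [Real.norm_eq_abs] using this
    · simp only [hUgt N (m + 1) (by omega), sub_self, abs_zero]
      have := hR0 T
      positivity
  -- Step 3: extraction of a convergent subsequence
  obtain ⟨φ, hφ, hconv⟩ := exists_subseq_tendsto (R := R)
    (fun t ht N n => hUabs t t ⟨ht, le_rfl⟩ N n) hlipU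
  set v : ℕ → ℝ → ℝ := fun n t => limUnder atTop fun j => U (φ j) n t with hv
  replace hconv : ∀ n t, 0 ≤ t → Tendsto (fun j => U (φ j) n t) atTop (𝓝 (v n t)) := hconv
  -- Step 4: first properties of the limit
  have hv0 : ∀ t, v 0 t = 0 := by
    intro t
    have : (fun j => U (φ j) 0 t) = fun _ => 0 := funext fun j => hU0 _ _
    simp only [hv, this]
    exact tendsto_const_nhds.limUnder_eq
  have hvinit : ∀ n, 1 ≤ n → v n 0 = u0 n := by
    intro n hn
    refine tendsto_nhds_unique (hconv n 0 le_rfl) (tendsto_const_nhds.congr' ?_)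
    filter_upwards [hφ.tendsto_atTop.eventually (eventually_ge_atTop n)] with j hj
    exact (hUinit (φ j) n hn hj).symm
  have hvlip : ∀ T, 0 ≤ T → ∀ n, ∃ L', ∀ s ∈ Icc 0 T, ∀ t ∈ Icc 0 T,
      |v n t - v n s| ≤ L' * |t - s| := by
    intro T hT n
    obtain ⟨L', hL'⟩ := hlipU T hT n
    exact ⟨L', fun s hs t ht => le_of_tendsto (((hconv n t ht.1).sub (hconv n s hs.1)).abs)
      (Eventually.of_forall fun j => hL' (φ j) s hs t ht)⟩
  have hvcontT : ∀ T, 0 ≤ T → ∀ n, ContinuousOn (v n) (Icc 0 T) := by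
    intro T hT n
    obtain ⟨L', hL'⟩ := hvlip T hT n
    have : LipschitzOnWith (Real.toNNReal L') (v n) (Icc 0 T) :=
      LipschitzOnWith.of_dist_le_mul fun s hs t ht => by
        rw [Real.dist_eq, Real.dist_eq]
        exact (hL' t ht s hs).trans
          (mul_le_mul_of_nonneg_right (Real.le_coe_toNNReal L') (abs_nonneg _))
    exact this.continuousOn
  have hvcont : ∀ n, ContinuousOn (v n) (Ici 0) := by
    intro n t ht
    have ht' : (0 : ℝ) ≤ t := ht
    have hmem : Icc 0 (t + 1) ∈ 𝓝[Ici 0] t :=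
      Filter.mem_of_superset (inter_mem_nhdsWithin (Ici (0 : ℝ)) (Iio_mem_nhds (by linarith)))
        fun s hs => ⟨hs.1, hs.2.le⟩
    exact (hvcontT (t + 1) (by linarith) n t ⟨ht', by linarith⟩).mono_of_mem_nhdsWithin hmem
  have hvmax : ∀ n, Continuous fun τ => v n (max τ 0) := fun n =>
    (hvcont n).comp_continuous (f := fun τ : ℝ => max τ 0) (continuous_id.max continuous_const)
      fun τ => Set.mem_Ici.2 (le_max_right τ 0)
  -- Step 5: the Galerkin equations in integral form
  have hUcont : ∀ N n T, ContinuousOn (U N n) (Icc 0 T) := by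
    intro N n T
    rcases Nat.eq_zero_or_pos n with rfl | hn
    · have : U N 0 = fun _ => 0 := funext fun t => hU0 N t
      rw [this]; exact continuousOn_const
    obtain ⟨m, rfl⟩ : ∃ m, n = m + 1 := ⟨n - 1, by omega⟩
    by_cases hm : m < N
    · exact fun t ht => (hUd N T m hm t ht).continuousWithinAt
    · have : U N (m + 1) = fun _ => 0 := funext fun t => hUgt N (m + 1) (by omega) t
      rw [this]; exact continuousOn_const
  have hint : ∀ N, ∀ m < N, ∀ t, 0 ≤ t → U N (m + 1) t =
      u0 (m + 1) + ∫ τ in (0 : ℝ)..t, cheskidovRHS lam ν α g (fun k => U N k τ) (m + 1) := by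
    intro N m hm t ht
    have hcRHS : ContinuousOn (fun τ => cheskidovRHS lam ν α g (fun k => U N k τ) (m + 1))
        (Icc 0 t) :=
      continuousOn_cheskidovRHS_succ (fun k => hUcont N k t) m
    have h := intervalIntegral.integral_eq_sub_of_hasDeriv_right_of_le ht (hUcont N (m + 1) t)
      (fun τ hτ => ((hUd N t m hm τ (Ioo_subset_Icc_self hτ)).mono_of_mem_nhdsWithin ?_))
      (hcRHS.intervalIntegrable_of_Icc ht)
    · rw [h, hUinit N (m + 1) (by omega) (by omega)]
      ring
    · exact mem_nhdsWithin.2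
        ⟨Iio t, isOpen_Iio, hτ.2, fun z hz => ⟨hτ.1.le.trans (le_of_lt hz.2), hz.1.le⟩⟩
  -- Step 6: passage to the limit in the integral form
  have hint_v : ∀ m t, 0 ≤ t → v (m + 1) t =
      u0 (m + 1) + ∫ τ in (0 : ℝ)..t, cheskidovRHS lam ν α g (fun k => v k τ) (m + 1) := by
    intro m t ht
    have h1 : Tendsto (fun j => U (φ j) (m + 1) t) atTop (𝓝 (v (m + 1) t)) := hconv _ t ht
    have h2 : Tendsto (fun j => u0 (m + 1) +
        ∫ τ in (0 : ℝ)..t, cheskidovRHS lam ν α g (fun k => U (φ j) k τ) (m + 1)) atTop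
        (𝓝 (u0 (m + 1) + ∫ τ in (0 : ℝ)..t, cheskidovRHS lam ν α g (fun k => v k τ) (m + 1))) := by
      refine tendsto_const_nhds.add ?_
      refine intervalIntegral.tendsto_integral_filter_of_dominated_convergence (fun _ => L m t)
        ?_ ?_ ?_ ?_
      · refine Eventually.of_forall fun j => ?_
        have hc := continuousOn_cheskidovRHS_succ (lam := lam) (ν := ν) (α := α) (g := g) (m := m)
          (fun k => hUcont (φ j) k t)
        rw [uIoc_of_le ht]
        exact (hc.mono Ioc_subset_Icc_self).aestronglyMeasurable measurableSet_Ioc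
      · refine Eventually.of_forall fun j => ae_of_all _ fun τ hτ => ?_
        rw [uIoc_of_le ht] at hτ
        rw [Real.norm_eq_abs]
        exact hderiv_bd (φ j) t τ (Ioc_subset_Icc_self hτ) m
      · exact intervalIntegrable_const
      · refine ae_of_all _ fun τ hτ => ?_
        rw [uIoc_of_le ht] at hτ
        exact tendsto_cheskidovRHS_succ (fun k => hconv k τ hτ.1.le) m
    have h3 : ∀ᶠ j in atTop, U (φ j) (m + 1) t =
        u0 (m + 1) + ∫ τ in (0 : ℝ)..t, cheskidovRHS lam ν α g (fun k => U (φ j) k τ) (m + 1) := by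
      filter_upwards [hφ.tendsto_atTop.eventually (eventually_gt_atTop m)] with j hj
      exact hint (φ j) m hj t ht
    exact tendsto_nhds_unique (h1.congr' h3) h2
  -- Step 7: differentiate the integral form
  have hderiv_v : ∀ m t, 0 ≤ t → HasDerivWithinAt (v (m + 1))
      (cheskidovRHS lam ν α g (fun k => v k t) (m + 1)) (Ici 0) t := by
    intro m t ht
    set f : ℝ → ℝ := fun τ => cheskidovRHS lam ν α g (fun k => v k (max τ 0)) (m + 1) with hf
    have hfc : Continuous f := continuous_cheskidovRHS_succ hvmax m
    have hΦ : HasDerivAt (fun s => u0 (m + 1) + ∫ τ in (0 : ℝ)..s, f τ) (f t) t :=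
      (intervalIntegral.integral_hasDerivAt_right (hfc.intervalIntegrable 0 t)
        (hfc.stronglyMeasurableAtFilter _ _) hfc.continuousAt).const_add _
    have heq : ∀ s ∈ Ici (0 : ℝ), v (m + 1) s = u0 (m + 1) + ∫ τ in (0 : ℝ)..s, f τ := by
      intro s hs
      have hs' : (0 : ℝ) ≤ s := hs
      rw [hint_v m s hs']
      congr 1
      refine intervalIntegral.integral_congr fun τ hτ => ?_
      rw [uIcc_of_le hs'] at hτ
      simp only [hf, max_eq_left hτ.1]
    have hft : f t = cheskidovRHS lam ν α g (fun k => v k t) (m + 1) := by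
      simp only [hf, max_eq_left ht]
    rw [← hft]
    exact hΦ.hasDerivWithinAt.congr (fun s hs => heq s hs) (heq t ht)
  -- Step 8: the energy bound passes to the limit on partial sums
  have hEv : ∀ T, 0 ≤ T → ∀ t ∈ Icc 0 T, ∀ M,
      ∑ m ∈ Finset.range M, v (m + 1) t ^ 2 ≤ R2 T := by
    intro T hT t ht M
    have hlimsum : Tendsto (fun j => ∑ m ∈ Finset.range M, U (φ j) (m + 1) t ^ 2) atTop
        (𝓝 (∑ m ∈ Finset.range M, v (m + 1) t ^ 2)) :=
      tendsto_finsetSum _ fun m _ => (hconv (m + 1) t ht.1).pow 2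
    exact le_of_tendsto hlimsum (Eventually.of_forall fun j => hEN' (φ j) T t ht M)
  -- conclusion
  refine ⟨v, ⟨hv0, hvinit, ?_, ?_⟩, ?_⟩
  · intro n hn t ht
    obtain ⟨m, rfl⟩ : ∃ m, n = m + 1 := ⟨n - 1, by omega⟩
    exact hderiv_v m t ht
  · intro t ht
    have hsum' : Summable fun m => v (m + 1) t ^ 2 :=
      summable_of_sum_range_le (fun m => sq_nonneg _) (hEv t ht t ⟨ht, le_rfl⟩)
    exact (summable_nat_add_iff 1).1 hsum'
  · intro T hT t ht M
    exact hEv T hT t ht M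

/-! ### Cheskidov–Friedlander 2009 / Cheskidov–Friedlander–Pavlović 2010, Thm. 3.2 -/

/-- **Cheskidov–Friedlander 2009, Theorem 3.2 (existence clause) and Cheskidov–Friedlander–Pavlović
2010, Theorem 3.2 — PROVED for every exponent and every viscosity `ν ≥ 0`**: for `c > 0`,
`ν ≥ 0`, any `f₀` and every datum `a⁰ ∈ ℓ²` (`Σ_j(a⁰_j)² < ∞`) there is a solution of the
Cheskidov–Friedlander system (1.2) on `[0,∞)` (Def. 3.1, `IsSolution`) with `a(0) = a⁰`.
(CF 2009 p. 7: "Let `a(0) ∈ l²`. Then there exists a solution … a classical result from [2]";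
CFP 2010 p. 4: "For every `a⁰ ∈ H`, there exists a solution of (1.2) on `[0,∞)` with `a(0) = a⁰`".)
From `exists_isCheskidovSolution_of_summable` through the dictionary
`IsSolution.of_isCheskidovSolution` (`λ = 2^c > 1`, `α = 1/c`, viscosity `ν/4`, one-mode shift).
[cite: CheskidovFriedlander2009, Thm 3.2 p.7] [cite: CheskidovFriedlanderPavlovic2010, Thm 3.2 p.4] [cite: Cheskidov2008, §4 Thm. 4.1] -/
theorem exists_isSolution_of_summable {c ν : ℝ} (hc : 0 < c) (hν : 0 ≤ ν) (f₀ : ℝ)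
    {a₀ : ℕ → ℝ} (ha₀ : Summable fun j => a₀ j ^ 2) :
    ∃ a : ℕ → ℝ → ℝ, IsSolution c ν (force f₀) a ∧ ∀ j, a j 0 = a₀ j := by
  have hL : (1 : ℝ) < (2 : ℝ) ^ c := Real.one_lt_rpow (by norm_num) hc
  have hL0 : (0 : ℝ) < (2 : ℝ) ^ c := by linarith
  have hK : (((2 : ℝ) ^ c) ^ 2) ≠ 0 := by positivity
  set g : ℕ → ℝ := fun n => match n with | 0 => 0 | m + 1 => (((2 : ℝ) ^ c) ^ 2)⁻¹ * force f₀ m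
    with hg_def
  set u0 : ℕ → ℝ := fun n => match n with | 0 => 0 | m + 1 => (((2 : ℝ) ^ c) ^ 2)⁻¹ * a₀ m
    with hu0_def
  have hgs : Summable fun n => g (n + 1) ^ 2 := by
    refine summable_of_ne_finset_zero (s := {0}) fun n hn => ?_
    rw [Finset.mem_singleton] at hn
    obtain ⟨m, rfl⟩ := Nat.exists_eq_succ_of_ne_zero hn
    simp [hg_def, force_succ]
  have hu0 : Summable fun n => u0 (n + 1) ^ 2 := by
    have : (fun n => u0 (n + 1) ^ 2) = fun n => ((((2 : ℝ) ^ c) ^ 2)⁻¹) ^ 2 * a₀ n ^ 2 := by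
      funext n; simp only [hu0_def]; ring
    rw [this]
    exact ha₀.mul_left _
  obtain ⟨u, hu, -⟩ :=
    exists_isCheskidovSolution_of_summable (α := 1 / c) hL (by positivity : (0 : ℝ) ≤ ν / 4) g hgs u0 hu0
  refine ⟨fun j t => ((2 : ℝ) ^ c) ^ 2 * u (j + 1) t,
    IsSolution.of_isCheskidovSolution hc.ne' hu (fun n => rfl), fun j => ?_⟩
  obtain ⟨-, hinit, -, -⟩ := hu
  simp only [hinit (j + 1) (by omega), hu0_def]
  field_simp

/-- **The inviscid model from non-negative data: the hypothesis class of CFP Thms. 4.3–4.5 and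
Cor. 4.6 is inhabited** — for every `c > 0`, `f₀` and every non-negative `ℓ²` datum there is a
solution of the inviscid model (`ν = 0`) from that datum with `a_j(0) ≥ 0` (so the proved
`CheskidovFriedlanderPavlovic2010_thm44_holds`, `…_thm43_holds`, `…_thm45_holds`, `…_cor46_holds`
are not vacuous). [cite: CheskidovFriedlanderPavlovic2010, Thm 3.2 p.4 and Thm 4.4 p.10] -/
theorem exists_isSolution_inviscid {c : ℝ} (hc : 0 < c) (f₀ : ℝ) {a₀ : ℕ → ℝ}
    (ha₀ : Summable fun j => a₀ j ^ 2) (hpos : ∀ j, 0 ≤ a₀ j) :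
    ∃ a : ℕ → ℝ → ℝ, IsSolution c 0 (force f₀) a ∧ (∀ j, a j 0 = a₀ j) ∧ ∀ j, 0 ≤ a j 0 := by
  obtain ⟨a, ha, h0⟩ := exists_isSolution_of_summable hc le_rfl f₀ ha₀
  exact ⟨a, ha, h0, fun j => by rw [h0 j]; exact hpos j⟩

/-- **The vanishing-viscosity families of Thms. 3.4/4.2 exist for every exponent**: for `c > 0`,
`f₀` and every `ℓ²` datum there is, for every `ν ≥ 0`, a solution of (1.2) from that datum
(upgrading `exists_solutionFamily` of `Existence.lean`, which needed `c ≤ 2`, `ν > 0`, `H¹` data).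
[cite: CheskidovFriedlander2009, Thm 3.2 p.7] -/
theorem exists_solutionFamily_of_summable {c : ℝ} (hc : 0 < c) (f₀ : ℝ) {a₀ : ℕ → ℝ}
    (ha₀ : Summable fun j => a₀ j ^ 2) :
    ∃ a : ℝ → ℕ → ℝ → ℝ, ∀ ν, 0 ≤ ν → IsSolution c ν (force f₀) (a ν) ∧ ∀ j, a ν j 0 = a₀ j := by
  have h : ∀ ν : ℝ, ∃ a : ℕ → ℝ → ℝ, 0 ≤ ν → IsSolution c ν (force f₀) a ∧ ∀ j, a j 0 = a₀ j := by
    intro ν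
    by_cases hν : 0 ≤ ν
    · obtain ⟨a, ha, h0⟩ := exists_isSolution_of_summable hc hν f₀ ha₀
      exact ⟨a, fun _ => ⟨ha, h0⟩⟩
    · exact ⟨fun _ _ => 0, fun h => absurd h hν⟩
  choose a ha using h
  exact ⟨a, fun ν hν => ha ν hν⟩

/-! ### Kolmogorov's zeroth law for the dyadic model, unconditionally and from every datum -/

/-- **Cheskidov–Friedlander 2009, Theorem 4.2 realised from every datum** (the dyadic zeroth
law, now unconditional: `CheskidovFriedlander2009_thm42_holds` + `exists_solutionFamily_of_summable`):
for `3/2 < c ≤ 5/2`, `f₀ > 0` and every non-negative `ℓ²` datum `a₀` there is a family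
`ν ↦ a^ν` of solutions of (1.2) from `a₀` (one for every `ν ≥ 0`) whose long-time mean
dissipations `L(ν) = lim_{T→∞}T⁻¹∫₀ᵀν‖a^ν‖²_{H¹}` exist for every `ν > 0` and tend to
`ε_d = f₀α⁰₀ > 0` as `ν → 0⁺`. [cite: CheskidovFriedlander2009, Thm 4.2 p.9 and Thm 3.2 p.7] -/
theorem CheskidovFriedlander2009_thm42_of_summable {c f₀ : ℝ} (hc : 3 / 2 < c) (hc' : c ≤ 5 / 2)
    (hf : 0 < f₀) {a₀ : ℕ → ℝ} (ha₀ : Summable fun j => a₀ j ^ 2) (hpos : ∀ j, 0 ≤ a₀ j) :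
    ∃ a : ℝ → ℕ → ℝ → ℝ, (∀ ν, 0 ≤ ν → IsSolution c ν (force f₀) (a ν) ∧ ∀ j, a ν j 0 = a₀ j) ∧
      ∃ L : ℝ → ℝ, (∀ ν, 0 < ν → Tendsto (meanDissipation ν (a ν)) atTop (𝓝 (L ν))) ∧
        Tendsto L (𝓝[>] 0) (𝓝 (epsilonD c f₀)) := by
  obtain ⟨a, ha⟩ := exists_solutionFamily_of_summable (c := c) (by linarith) f₀ ha₀
  refine ⟨a, ha, ?_⟩
  exact CheskidovFriedlander2009_thm42_holds c hc hc' f₀ hf a fun ν hν =>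
    ⟨(ha ν hν.le).1, fun j => by rw [(ha ν hν.le).2 j]; exact hpos j⟩

/-- **The dissipation floor from every non-negative `ℓ²` datum — unconditional** (upgrading
`CheskidovFriedlander2009_thm42.exists_floor` of `Existence.lean`: no hypothesis `h`, `c ≤ 5/2`
instead of `c ≤ 2`, `ℓ²` instead of `H¹` data, and the family includes `ν = 0`): for
`3/2 < c ≤ 5/2`, `f₀ > 0`, `a₀ ≥ 0` in `ℓ²` and any `ε < ε_d` there are solutions `a^ν` from `a₀`
(`ν ≥ 0`) and `ν₀ > 0` with `T⁻¹∫₀ᵀν‖a^ν‖²_{H¹} > ε` for all large `T`, for every `0 < ν < ν₀`.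
[cite: CheskidovFriedlander2009, Thm 4.2 p.9 and Thm 3.2 p.7] -/
theorem CheskidovFriedlander2009_zerothLaw_floor {c f₀ : ℝ} (hc : 3 / 2 < c) (hc' : c ≤ 5 / 2)
    (hf : 0 < f₀) {a₀ : ℕ → ℝ} (ha₀ : Summable fun j => a₀ j ^ 2) (hpos : ∀ j, 0 ≤ a₀ j) {ε : ℝ}
    (hε : ε < epsilonD c f₀) :
    ∃ a : ℝ → ℕ → ℝ → ℝ, (∀ ν, 0 ≤ ν → IsSolution c ν (force f₀) (a ν) ∧ ∀ j, a ν j 0 = a₀ j) ∧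
      ∃ ν₀ : ℝ, 0 < ν₀ ∧ ∀ ν, 0 < ν → ν < ν₀ → ∀ᶠ T in atTop, ε < meanDissipation ν (a ν) T := by
  obtain ⟨a, ha⟩ := exists_solutionFamily_of_summable (c := c) (by linarith) f₀ ha₀
  refine ⟨a, ha, ?_⟩
  exact CheskidovFriedlander2009_thm42_holds.floor hc hc' hf
    (fun ν hν => ⟨(ha ν hν.le).1, fun j => by rw [(ha ν hν.le).2 j]; exact hpos j⟩) hε

end Literature.Analysis.FluidPDE.CheskidovFriedlander2009

end
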